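import Summits.QuantumFields.YangMills.Theorems.FemtoTransferGap
import Literature.MathematicalPhysics.QuantumFieldTheory.Balaban1983to89.MassGapTransferHC

/-!
# Femto transfer gap — zero-mode universality ON THE NOSE: the transfer kernel of `(ℤ/L)³` on spatially CONSTANT configurations is the
# one-site kernel at the scaled coupling `L³β`

Lead seat `ym-line-fcl-p1` (2026-08-28), for crux `FixedLatticeLaw` (stmt-QuantumFields-23943 = tree leaf `FemtoGapFixedLattice`) of route
`FemtoCutoffLadder`.  The mechanism behind the fixed-lattice Lüscher law `z(β,L) → ε₁λ_b(β)` at EVERY `L` (and behind the registered stub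
`stub_fixedLReduction`: reduction of the `L`-lattice zero-flux transfer values to the one-site values at coupling `βL³`) is that the constant
(zero-momentum) modes of `(ℤ/L)³` at coupling `β` ARE the one-site three-matrix model at coupling `L³β`: a spatially constant configuration
`U(x,i) = u_i` has Wilson action `L³·S₁(u)` and time coupling `L³·T₁(u,v)`, so `K_{β,L}(u,v) = K_{L³β,1}(u,v)` exactly; with
`λ_b(L³β) = λ_b(β)/L` (`bareLambda_cube_mul`) this is the `ε₁λ_b/L` law per time step at leading order.  Proved here as kernel identities
(any group `G`, any matrix representation `ρ`):

* `plaquetteHolonomy_const`, `wilsonAction_const` (`S_L(const u) = L³·Σ_{i<j}(N − Re tr ρ[u_i,u_j])`), `timeCoupling_const`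
  (`T_L = L³·Σ_i Re tr ρ(u_i v_i⁻¹)`), ★ `transferKernel_const` (`K_{β,L}(const u, const v) = K_{L³β,1}(const u, const v)`), and
  `transferKernel_one_site_eq_const` (every one-site configuration is constant).

HONEST FRAMING: an exact algebraic identity about the kernel on a measure-zero set of configurations; it is NOT the Born–Oppenheimer reduction
(the `9(L³−1)` non-constant modes are the whole difficulty of `FixedLatticeLaw` for `L ≥ 2`), proves no spectral statement, and has nothing
to do with infinite volume, a mass gap or Clay.  No definitions (constant configurations are written as lambdas), no named facts, no `sorry`.
-/

set_option autoImplicit false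

noncomputable section

open Literature.MathematicalPhysics.QuantumFieldTheory
open Literature.MathematicalPhysics.QuantumLattice

namespace Summit.QuantumFields.YangMills.Theorems.FemtoTransferGap

variable {N : ℕ} {G : Type*} [Group G] (ρ : G →* Matrix (Fin N) (Fin N) ℂ)

/-- Plaquette holonomies of a constant configuration are the group commutators `u_i u_j u_i⁻¹ u_j⁻¹`, the same at every site. [cite: Luscher1983, §2] -/
theorem plaquetteHolonomy_const {L : ℕ} (u : Fin 3 → G) (x : Site 3 L) (i j : Fin 3) :
    plaquetteHolonomy (fun e : Edge 3 L => u e.2) x i j = u i * u j * (u i)⁻¹ * (u j)⁻¹ := rfl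

/-- **Wilson action of a constant configuration**: `S_L(const u) = L³ · Σ_{i<j} (N − Re tr ρ(u_i u_j u_i⁻¹ u_j⁻¹))`. [cite: Luscher1983, §2] -/
theorem wilsonAction_const (L : ℕ) [NeZero L] (u : Fin 3 → G) :
    wilsonAction ρ (fun e : Edge 3 L => u e.2) =
      (L : ℝ) ^ 3 * ∑ p : {p : Fin 3 × Fin 3 // p.1 < p.2}, ((N : ℝ) - (ρ (u p.1.1 * u p.1.2 * (u p.1.1)⁻¹ * (u p.1.2)⁻¹)).trace.re) := by
  have hcard : Fintype.card (Site 3 L) = L ^ 3 :=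
    Literature.MathematicalPhysics.QuantumFieldTheory.card_site_three L
  unfold wilsonAction
  rw [Fintype.sum_prod_type]
  simp only [plaquetteHolonomy_const]
  rw [Finset.sum_const, Finset.card_univ, hcard, nsmul_eq_mul]
  push_cast
  ring

/-- **Time coupling of two constant configurations**: `T_L(const u, const v) = L³ · Σ_i Re tr ρ(u_i v_i⁻¹)`. [cite: SeilerLNP1982, §3] -/
theorem timeCoupling_const (L : ℕ) [NeZero L] (u v : Fin 3 → G) :
    timeCoupling ρ (fun e : Edge 3 L => u e.2) (fun e : Edge 3 L => v e.2) =
      (L : ℝ) ^ 3 * ∑ i : Fin 3, (ρ (u i * (v i)⁻¹)).trace.re := by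
  have hcard : Fintype.card (Site 3 L) = L ^ 3 :=
    Literature.MathematicalPhysics.QuantumFieldTheory.card_site_three L
  unfold timeCoupling
  rw [Fintype.sum_prod_type]
  simp only
  rw [Finset.sum_const, Finset.card_univ, hcard, nsmul_eq_mul]
  push_cast
  ring

/-- ★ **Zero-mode universality of the kernel**: on spatially constant configurations the transfer kernel of `(ℤ/L)³` at coupling `β` equals the
ONE-SITE transfer kernel at coupling `L³β`: `K_{β,L}(const u, const v) = K_{L³β,1}(const u, const v)`. [cite: Luscher1983, §2–§3] -/
theorem transferKernel_const (L : ℕ) [NeZero L] (β : ℝ) (u v : Fin 3 → G) :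
    transferKernel ρ β (fun e : Edge 3 L => u e.2) (fun e : Edge 3 L => v e.2) =
      transferKernel ρ ((L : ℝ) ^ 3 * β) (fun e : Edge 3 1 => u e.2) (fun e : Edge 3 1 => v e.2) := by
  unfold transferKernel
  rw [timeCoupling_const, timeCoupling_const, wilsonAction_const, wilsonAction_const, wilsonAction_const, wilsonAction_const]
  push_cast
  ring_nf

omit [Group G] in
/-- Every one-site configuration is constant: `U = (e ↦ U(0, e.2))` on `(ℤ/1)³`. [folklore] -/
theorem one_site_eq_const (U : GaugeConfig 3 1 G) : U = fun e : Edge 3 1 => (fun i : Fin 3 => U (0, i)) e.2 := by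
  funext e
  have hx : e.1 = 0 := Subsingleton.elim _ _
  show U e = U (0, e.2)
  rw [← hx]

/-- The one-site kernel at coupling `L³β`, read on honest one-site configurations `U, V`, equals the `(ℤ/L)³` kernel at coupling `β` on their
constant extensions `x ↦ U(0,i)`. [cite: Luscher1983, §3] -/
theorem transferKernel_one_site_eq_const (L : ℕ) [NeZero L] (β : ℝ) (U V : GaugeConfig 3 1 G) :
    transferKernel ρ ((L : ℝ) ^ 3 * β) U V =
      transferKernel ρ β (fun e : Edge 3 L => U (0, e.2)) (fun e : Edge 3 L => V (0, e.2)) := by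
  conv_lhs => rw [one_site_eq_const U, one_site_eq_const V]
  exact (transferKernel_const ρ L β (fun i => U (0, i)) (fun i => V (0, i))).symm

end Summit.QuantumFields.YangMills.Theorems.FemtoTransferGap

end
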